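import Summits.KontsevichZagierPeriods.KontsevichZagierPeriods.Theorems.SymplecticScissorsRealOnePeriodRelationsStubTransferTorsC
import Summits.KontsevichZagierPeriods.KontsevichZagierPeriods.Theorems.SymplecticScissorsRealOnePeriodRelationsStubFormReductionP

/-!
# Crux `RealOnePeriodRelations` (stmt-KontsevichZagierPeriods-10042), line `nash-retraction-thin-strip`, reshape 10:
# the registered stub `stub_transferTors` (lead) — every symbol on `C_T` moves to `E_L ∪ 𝔾ₘ ∪ 𝔸¹`

`stub_transferTors`: for a finite set `T` of torsion abscissae, every period symbol `(C_T, ω, γ)` on the torsion-punctured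
Weierstrass curve is, modulo the `ℚ̄`-span of the elementary relations (R1)–(R4), a `ℚ̄`-combination `V` of symbols on
`E_L`, on `𝔾ₘ = {xy = 1}` (logarithms) and on `𝔸¹` (the unit symbol).  Proof: the de Rham reduction `stub_formReductionP`
writes `ω = a Θ₀ + b Θ₁ + Σ_t e_t dx/(x − t) + Σ_t o_t ξ_t + dF + ν`, and each piece is transferred by
`transfer_Theta0/Theta1/dlogV/Xi/exact/vanish` (`…StubTransferTorsA/B.lean`), combined by `transfer_combo`.  The only
non-classical step is the third-kind piece `ξ_t`: the torsion units of `stub_torsUnit` turn it into logarithm symbols.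
[cite: HuberWustholz2022, Thm 13.3 (2), §13.1 (B), §13.2] [cite: SilvermanAEC2009, III.3.5]
-/

noncomputable section

open scoped BigOperators Topology PeriodPair
open Set Filter MvPolynomial Complex
open Literature.NumberTheory.Transcendental Literature.NumberTheory.Transcendental.CurvePeriods
open Literature.NumberTheory.Transcendental.CurvePeriods.Ell

namespace Summit.KontsevichZagierPeriods.SymplecticScissors.RealOnePeriodRelations

namespace TorsionLayer

/-- STUB `stub_transferTors` (lead) — **every symbol on `C_T` is elementary-equivalent to symbols on `E_L`, logarithm
symbols on `𝔾ₘ` and `𝟙`** (`stub_formReductionP`; (R1)–(R3); (R4) along `ι : C_T → E_L` for `θ₀, θ₁`, along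
`(x − t, (x − t)⁻¹) : C_T → 𝔾ₘ` for `dx/(x − t)`, and along `(G_±, c⁻¹ G_∓ (x − t)^{−N}) : C_T → 𝔾ₘ` for the third-kind
classes `N ℘′(v_t)/2 · ξ_t = ½(dlog G₊ − dlog G₋) + λ θ₀` (`stub_torsUnit`); `2`-torsion abscissae `t` have `ξ_t` of the
second kind: `℘′(t)... f′(t)/2 · ξ_t = ½(θ₁ − t θ₀) − d(y/(x − t))`). [cite: HuberWustholz2022, §13.1 (B), §13.2] -/
theorem stub_transferTors (L : PeriodPair) (h₂ : IsAlgebraic ℚ L.g₂) (h₃ : IsAlgebraic ℚ L.g₃) (T : Finset ℂ)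
    (hT : ∀ a ∈ T, ∃ v : ℂ, IsAlgPt L v ∧ (∃ n : ℕ, 1 ≤ n ∧ (n : ℂ) * v ∈ L.lattice) ∧ ℘[L] v = a)
    (hTalg : ∀ a ∈ T, IsAlgebraic ℚ a)
    (ω : Fin 3 → MvPolynomial (Fin 3) ℂ) (hω : ∀ i, HasAlgCoeffs (ω i)) (γ : CurvePath (curveP L T)) :
    ∃ V : PeriodSymbol →₀ ℂ, (∀ t, IsAlgebraic ℚ (V t)) ∧
      (∃ (k : ℕ) (ρ : Fin k → (PeriodSymbol →₀ ℂ)) (a : Fin k → ℂ),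
      (∀ l, IsElementaryRelation (ρ l)) ∧ (∀ l, IsAlgebraic ℚ (a l)) ∧ (Finsupp.single (⟨curveP L T, smoothP L h₂ h₃ hTalg, ω, hω, γ⟩ : PeriodSymbol) 1 - V) = ∑ l, a l • ρ l) ∧
      ∀ t ∈ V.support, t.Z = curve L ∨ t.Z = (⟨2, 1, ![X 0 * X 1 - 1]⟩ : CurveData) ∨ t.Z = CurveData.affineLine := by
  classical
  obtain ⟨a, b, e, o, F, ν, ha, hb, he, ho, hF, hν, hv, heq⟩ := stub_formReductionP L h₂ h₃ T hTalg ω hω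
  have hΘ0 := hasAlgCoeffs_Theta0 L h₂ h₃
  have hΘ1 := hasAlgCoeffs_Theta1 L h₂ h₃
  -- coefficients extended by `0` off `T` (so that they are algebraic everywhere)
  let e' : ℂ → ℂ := fun t => if t ∈ T then e t else 0
  let o' : ℂ → ℂ := fun t => if t ∈ T then o t else 0
  have he' : ∀ t, IsAlgebraic ℚ (e' t) := fun t => by
    by_cases ht : t ∈ T
    · simp only [e', if_pos ht]; exact he t ht
    · simp only [e', if_neg ht]; exact isAlgebraic_zero
  have ho' : ∀ t, IsAlgebraic ℚ (o' t) := fun t => by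
    by_cases ht : t ∈ T
    · simp only [o', if_pos ht]; exact ho t ht
    · simp only [o', if_neg ht]; exact isAlgebraic_zero
  have hesum : ∑ t ∈ T, e' t • dlogV T t = ∑ t ∈ T, e t • dlogV T t :=
    Finset.sum_congr rfl fun t ht => by simp only [e', if_pos ht]
  have hosum : ∑ t ∈ T, o' t • Xi L T t = ∑ t ∈ T, o t • Xi L T t :=
    Finset.sum_congr rfl fun t ht => by simp only [o', if_pos ht]
  -- the two `T`-indexed sums as single transferable pieces
  have hDa : ∀ k, HasAlgCoeffs ((∑ t ∈ T, e' t • dlogV T t) k) :=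
    fun k => hasAlgCoeffs_sum_apply T _ (fun t k => (hasAlgCoeffs_dlogV hTalg t k).smul (he' t)) k
  have hXa : ∀ k, HasAlgCoeffs ((∑ t ∈ T, o' t • Xi L T t) k) :=
    fun k => hasAlgCoeffs_sum_apply T _ (fun t k => (hasAlgCoeffs_Xi L h₂ h₃ hTalg t k).smul (ho' t)) k
  have hVD := transfer_combo L h₂ h₃ hTalg γ T (fun t => dlogV T t) (fun t => hasAlgCoeffs_dlogV hTalg t) e' he'
    (fun t ht => transfer_dlogV L h₂ h₃ hTalg ht γ) (∑ t ∈ T, e' t • dlogV T t) hDa rfl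
  have hVX := transfer_combo L h₂ h₃ hTalg γ T (fun t => Xi L T t) (fun t => hasAlgCoeffs_Xi L h₂ h₃ hTalg t) o' ho'
    (fun t ht => transfer_Xi L h₂ h₃ hTalg ht (hT t ht) γ) (∑ t ∈ T, o' t • Xi L T t) hXa rfl
  -- the six pieces
  let pieces : Fin 6 → Fin 3 → MvPolynomial (Fin 3) ℂ :=
    ![Theta0 L, Theta1 L, formD F, ν, ∑ t ∈ T, e' t • dlogV T t, ∑ t ∈ T, o' t • Xi L T t]
  let cf : Fin 6 → ℂ := ![a, b, 1, 1, 1, 1]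
  have hpieces : ∀ i k, HasAlgCoeffs (pieces i k) := by
    intro i k
    fin_cases i
    · exact hΘ0 k
    · exact hΘ1 k
    · exact hF.formD k
    · exact hν k
    · exact hDa k
    · exact hXa k
  have hcf : ∀ i, IsAlgebraic ℚ (cf i) := by
    intro i
    fin_cases i
    · exact ha
    · exact hb
    · exact isAlgebraic_one
    · exact isAlgebraic_one
    · exact isAlgebraic_one
    · exact isAlgebraic_one
  have heq' : ω = ∑ i ∈ Finset.univ, cf i • pieces i := by
    rw [Fin.sum_univ_six]
    show ω = a • Theta0 L + b • Theta1 L + (1 : ℂ) • formD F + (1 : ℂ) • ν +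
      (1 : ℂ) • (∑ t ∈ T, e' t • dlogV T t) + (1 : ℂ) • (∑ t ∈ T, o' t • Xi L T t)
    rw [one_smul, one_smul, one_smul, one_smul, hesum, hosum, heq]
    abel
  obtain ⟨V, hValg, hVrel, hVsupp⟩ := transfer_combo L h₂ h₃ hTalg γ Finset.univ pieces hpieces cf hcf (fun i _ => by
    fin_cases i
    · exact transfer_Theta0 L h₂ h₃ hTalg γ
    · exact transfer_Theta1 L h₂ h₃ hTalg γ
    · exact transfer_exact L h₂ h₃ hTalg hF γ
    · exact transfer_vanish L h₂ h₃ hTalg hν hv γ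
    · exact hVD
    · exact hVX) ω hω heq'
  exact ⟨V, hValg, hVrel, hVsupp⟩

end TorsionLayer

end Summit.KontsevichZagierPeriods.SymplecticScissors.RealOnePeriodRelations

end
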